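import Mathlib.Data.List.Basic
import HarnessLib

/-!
# The ROUTER-WORD SCORE (ACCEPTANCE §4.2) as a total function, with its honesty / monotonicity
# property sheet proved

Venture CertifiedManyBodySolver, cell `pub/hubbard-downfold` (HUMAN RULINGS D-0098/D-0099: the
material oracle is scored against a curated validation set; stage-1 score = «is the ROUTER's branch
word the pre-registered one?»), seat hubbard-downfold-score-2; namespace
`Summit.Ventures.CertifiedManyBodySolver.Downfold.RouterScore`. Everything here is PROVED.

WHAT THIS IS NOT: not a statement about any material and not the scorer of record — the scorer of
record is `ladder-directors/deputy-2/score.py::router_score` (ACCEPTANCE.md v1.2 §4.2), mirrored by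
`pub/hubbard-downfold/validation/score/router/router_score.py::outcome` (cross-tested, 0 differences on
23 cases). This file is the KERNEL REFERENCE both python engines are tested against (§5 examples = the
same 23 cases on code HEADS), and the place where the properties the ACCEPTANCE text asserts in prose
are theorems:

* §2 `outcome structural e alts : Outcome` — `e` = emitted words (code heads, primary first), `alts` =
  the truth file's `expected_router_words` (each alternative a head list, primary first),
  `structural` = the heads that mean «no structure to model» (`UND:STRUCT`, `UND:DISPUTED`).
  Order of the clauses is exactly the python: no word ⇒ `ABSTAIN_noWord`; no expectation ⇒ `UNSCORED`;
  structural primary where no alternative expects one ⇒ `ABSTAIN_structure`; some alternative with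
  the same primary and all its tokens emitted ⇒ `AGREE`; else some alternative's primary emitted ⇒ `PARTIAL`;
  else `DISAGREE`. (The scorer's `ABSTAIN(uncoded)` / `ABSTAIN(pending)` refine the ill-formed / empty
  input and live in the string grammar, not here.)
* §3 THEOREMS («extra annotations never hurt», ACCEPTANCE §4.2): `outcome_agree_mono` — enlarging the
  emitted list with the primary kept preserves `AGREE`; `outcome_partial_mono` — it never degrades
  `PARTIAL` to `DISAGREE`; `outcome_congr_mem` — the verdict depends on the primary and on the SET of
  emitted heads only (order of secondaries immaterial); `outcome_structural_abstain` /
  `outcome_structural_ne_disagree` — HONESTY: a structural primary where none is expected is an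
  abstention, never a disagreement («undetermined counted, not a miss»); `outcome_agree_append_alts` —
  adding alternatives to the expectation preserves `AGREE`.
* §4 the code heads of the ROUTER grammar as a finite type; §5 the 23 cross-test cases by `decide`.
-/

namespace Summit.Ventures.CertifiedManyBodySolver.Downfold

namespace RouterScore

/-! ## §1 Outcomes -/

/-- The six outcomes of the router-word score (ACCEPTANCE §4.2; the two producer-state refinements
`ABSTAIN(uncoded)`, `ABSTAIN(pending)` of the scorer are string-grammar matters outside this model).
[folklore] -/
inductive Outcome
  /-- some alternative: same primary, all its tokens among the emitted words -/
  | AGREE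
  /-- not `AGREE`, but some alternative's primary is among the emitted words -/
  | PARTIAL
  /-- scored and neither of the above -/
  | DISAGREE
  /-- nothing emitted -/
  | ABSTAIN_noWord
  /-- a structural primary (`UND:STRUCT` / `UND:DISPUTED`) where no alternative expects one -/
  | ABSTAIN_structure
  /-- no expectation registered (hold-out before calibration close) -/
  | UNSCORED
  deriving DecidableEq, Repr

variable {α : Type*} [DecidableEq α]

/-! ## §2 The score -/

/-- every token of alternative `a` occurs among the emitted words `e` [folklore] -/
def covers (e a : List α) : Bool := a.all fun t => decide (t ∈ e)

/-- alternative `a` FULLY matches: same primary (head) and all its tokens emitted [folklore] -/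
def fullMatch (e a : List α) : Bool := decide (a.head? = e.head?) && covers e a

/-- alternative `a`'s primary occurs somewhere among the emitted words [folklore] -/
def primaryEmitted (e a : List α) : Bool :=
  match a.head? with
  | some p => decide (p ∈ e)
  | none => false

/-- some alternative EXPECTS a structural primary [folklore] -/
def expectsStructural (structural : α → Bool) (alts : List (List α)) : Bool :=
  alts.any fun a => match a.head? with
    | some q => structural q
    | none => false

/-- ACCEPTANCE §4.2 router-word score, clause order verbatim from `score.py::router_score`.
[folklore] -/
def outcome (structural : α → Bool) (e : List α) (alts : List (List α)) : Outcome :=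
  match e with
  | [] => .ABSTAIN_noWord
  | p :: _ =>
    if alts = [] then .UNSCORED
    else if structural p && !expectsStructural structural alts then .ABSTAIN_structure
    else if alts.any (fullMatch e) then .AGREE
    else if alts.any (primaryEmitted e) then .PARTIAL
    else .DISAGREE

/-! ## §3 Property sheet -/

section props

variable (structural : α → Bool)

/-- the score on a nonempty emitted list, as the chain of clauses (definitional unfolding). [folklore] -/
theorem outcome_cons (p : α) (tl : List α) (alts : List (List α)) :
    outcome structural (p :: tl) alts =
      (if alts = [] then Outcome.UNSCORED
       else if (structural p && !expectsStructural structural alts) then .ABSTAIN_structure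
       else if alts.any (fullMatch (p :: tl)) then .AGREE
       else if alts.any (primaryEmitted (p :: tl)) then .PARTIAL
       else .DISAGREE) := rfl

/-- nothing emitted is an abstention (never a disagreement). [folklore] -/
theorem outcome_nil (alts : List (List α)) : outcome structural [] alts = .ABSTAIN_noWord := rfl

/-- `covers` is monotone in the emitted list. [folklore] -/
theorem covers_mono {e e' a : List α} (hsub : ∀ t ∈ e, t ∈ e') (h : covers e a = true) :
    covers e' a = true := by
  simp only [covers, List.all_eq_true, decide_eq_true_eq] at h ⊢
  exact fun t ht => hsub t (h t ht)

/-- `fullMatch` is monotone in the emitted list when the primary is kept. [folklore] -/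
theorem fullMatch_mono {e e' a : List α} (hhead : e'.head? = e.head?) (hsub : ∀ t ∈ e, t ∈ e')
    (h : fullMatch e a = true) : fullMatch e' a = true := by
  simp only [fullMatch, Bool.and_eq_true, decide_eq_true_eq] at h ⊢
  exact ⟨h.1.trans hhead.symm, covers_mono hsub h.2⟩

/-- `primaryEmitted` is monotone in the emitted list. [folklore] -/
theorem primaryEmitted_mono {e e' a : List α} (hsub : ∀ t ∈ e, t ∈ e')
    (h : primaryEmitted e a = true) : primaryEmitted e' a = true := by
  unfold primaryEmitted at h ⊢
  cases ha : a.head? with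
  | none => simp [ha] at h
  | some q =>
    simp only [ha, decide_eq_true_eq] at h ⊢
    exact hsub q h

omit [DecidableEq α] in
/-- `List.any` is monotone under a pointwise implication of the predicates. [folklore] -/
theorem any_mono {l : List (List α)} {f g : List α → Bool} (hfg : ∀ a, f a = true → g a = true)
    (h : l.any f = true) : l.any g = true := by
  rw [List.any_eq_true] at h ⊢
  obtain ⟨a, ha, hfa⟩ := h
  exact ⟨a, ha, hfg a hfa⟩

/-- «EXTRA ANNOTATIONS NEVER HURT» (ACCEPTANCE §4.2): enlarging the emitted word list while keeping the
primary preserves `AGREE`. [folklore] -/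
theorem outcome_agree_mono {p : α} {tl tl' : List α} {alts : List (List α)}
    (hsub : ∀ t ∈ p :: tl, t ∈ p :: tl')
    (h : outcome structural (p :: tl) alts = .AGREE) :
    outcome structural (p :: tl') alts = .AGREE := by
  rw [outcome_cons] at h ⊢
  by_cases h0 : alts = []
  · rw [if_pos h0] at h; exact absurd h (by decide)
  rw [if_neg h0] at h ⊢
  by_cases hg : (structural p && !expectsStructural structural alts) = true
  · rw [if_pos hg] at h; exact absurd h (by decide)
  rw [if_neg hg] at h ⊢
  by_cases hm : alts.any (fullMatch (p :: tl)) = true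
  · have hm' : alts.any (fullMatch (p :: tl')) = true :=
      any_mono (fun a ha => fullMatch_mono (by simp) hsub ha) hm
    rw [if_pos hm']
  rw [if_neg hm] at h
  by_cases hq : alts.any (primaryEmitted (p :: tl)) = true
  · rw [if_pos hq] at h; exact absurd h (by decide)
  · rw [if_neg hq] at h; exact absurd h (by decide)

/-- enlarging the emitted list while keeping the primary never degrades `PARTIAL` below `PARTIAL`
(it may upgrade it to `AGREE`). [folklore] -/
theorem outcome_partial_mono {p : α} {tl tl' : List α} {alts : List (List α)}
    (hsub : ∀ t ∈ p :: tl, t ∈ p :: tl')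
    (h : outcome structural (p :: tl) alts = .PARTIAL) :
    outcome structural (p :: tl') alts = .AGREE ∨ outcome structural (p :: tl') alts = .PARTIAL := by
  rw [outcome_cons] at h ⊢
  by_cases h0 : alts = []
  · rw [if_pos h0] at h; exact absurd h (by decide)
  rw [if_neg h0] at h ⊢
  by_cases hg : (structural p && !expectsStructural structural alts) = true
  · rw [if_pos hg] at h; exact absurd h (by decide)
  rw [if_neg hg] at h ⊢
  by_cases hm' : alts.any (fullMatch (p :: tl')) = true
  · rw [if_pos hm']; exact Or.inl rfl
  rw [if_neg hm']
  by_cases hm : alts.any (fullMatch (p :: tl)) = true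
  · rw [if_pos hm] at h; exact absurd h (by decide)
  rw [if_neg hm] at h
  by_cases hq : alts.any (primaryEmitted (p :: tl)) = true
  · have hq' : alts.any (primaryEmitted (p :: tl')) = true :=
      any_mono (fun a ha => primaryEmitted_mono hsub ha) hq
    rw [if_pos hq']; exact Or.inr rfl
  · rw [if_neg hq] at h; exact absurd h (by decide)

/-- the verdict depends only on the primary and on the SET of emitted heads (order and repetition of
the secondaries are immaterial). [folklore] -/
theorem outcome_congr_mem {p : α} {tl tl' : List α} (alts : List (List α))
    (hmem : ∀ t, t ∈ p :: tl ↔ t ∈ p :: tl') :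
    outcome structural (p :: tl') alts = outcome structural (p :: tl) alts := by
  have hc : ∀ a, covers (p :: tl') a = covers (p :: tl) a := by
    intro a
    unfold covers
    congr 1
    funext t
    rw [decide_eq_decide]
    exact (hmem t).symm
  have hf : (fun a => fullMatch (p :: tl') a) = fun a => fullMatch (p :: tl) a := by
    funext a; unfold fullMatch; rw [List.head?_cons, List.head?_cons, hc]
  have hp : (fun a => primaryEmitted (p :: tl') a) = fun a => primaryEmitted (p :: tl) a := by
    funext a
    unfold primaryEmitted
    cases a.head? with
    | none => rfl
    | some q => rw [decide_eq_decide]; exact (hmem q).symm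
  rw [outcome_cons, outcome_cons]
  have hf' : alts.any (fullMatch (p :: tl')) = alts.any (fullMatch (p :: tl)) := by
    change alts.any (fun a => fullMatch (p :: tl') a) = alts.any (fun a => fullMatch (p :: tl) a)
    rw [hf]
  have hp' : alts.any (primaryEmitted (p :: tl')) = alts.any (primaryEmitted (p :: tl)) := by
    change alts.any (fun a => primaryEmitted (p :: tl') a) = alts.any (fun a => primaryEmitted (p :: tl) a)
    rw [hp]
  rw [hf', hp']

/-- HONESTY («undetermined counted, not a miss»): a structural primary where no alternative expects
one is an ABSTENTION. [folklore] -/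
theorem outcome_structural_abstain {p : α} {tl : List α} {alts : List (List α)}
    (halts : alts ≠ []) (hp : structural p = true)
    (hexp : expectsStructural structural alts = false) :
    outcome structural (p :: tl) alts = .ABSTAIN_structure := by
  rw [outcome_cons, if_neg halts, if_pos (by simp [hp, hexp])]

/-- … and in particular never a `DISAGREE`, whatever the alternatives are. [folklore] -/
theorem outcome_structural_ne_disagree {p : α} {tl : List α} {alts : List (List α)}
    (hp : structural p = true) (hexp : expectsStructural structural alts = false) :
    outcome structural (p :: tl) alts ≠ .DISAGREE := by
  by_cases halts : alts = []
  · rw [outcome_cons, if_pos halts]; decide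
  · rw [outcome_structural_abstain structural halts hp hexp]; decide

omit [DecidableEq α] in
/-- `expectsStructural` is monotone under appending alternatives. [folklore] -/
theorem expectsStructural_append_left {alts more : List (List α)}
    (h : expectsStructural structural alts = true) :
    expectsStructural structural (alts ++ more) = true := by
  unfold expectsStructural at h ⊢
  rw [List.any_append, h, Bool.true_or]

/-- ALTERNATIVES ARE ALTERNATIVES: adding alternatives to the expectation preserves `AGREE`.
[folklore] -/
theorem outcome_agree_append_alts {p : α} {tl : List α} {alts more : List (List α)}
    (h : outcome structural (p :: tl) alts = .AGREE) :
    outcome structural (p :: tl) (alts ++ more) = .AGREE := by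
  rw [outcome_cons] at h ⊢
  by_cases h0 : alts = []
  · rw [if_pos h0] at h; exact absurd h (by decide)
  rw [if_neg h0] at h
  rw [if_neg (by simp [h0])]
  by_cases hg : (structural p && !expectsStructural structural alts) = true
  · rw [if_pos hg] at h; exact absurd h (by decide)
  rw [if_neg hg] at h
  have hg' : ¬ (structural p && !expectsStructural structural (alts ++ more)) = true := by
    intro hc
    apply hg
    simp only [Bool.and_eq_true, Bool.not_eq_true'] at hc ⊢
    refine ⟨hc.1, ?_⟩
    by_contra hx
    have hx' : expectsStructural structural alts = true := by
      cases hv : expectsStructural structural alts with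
      | true => rfl
      | false => exact absurd hv hx
    have := expectsStructural_append_left structural (more := more) hx'
    rw [this] at hc
    exact Bool.noConfusion hc.2
  rw [if_neg hg']
  by_cases hm : alts.any (fullMatch (p :: tl)) = true
  · have : (alts ++ more).any (fullMatch (p :: tl)) = true := by
      rw [List.any_append, hm, Bool.true_or]
    rw [if_pos this]
  rw [if_neg hm] at h
  by_cases hq : alts.any (primaryEmitted (p :: tl)) = true
  · rw [if_pos hq] at h; exact absurd h (by decide)
  · rw [if_neg hq] at h; exact absurd h (by decide)

/-- characterisation of `AGREE` on a nonempty emitted list with a registered expectation and a closed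
structure gate: some alternative fully matches. [folklore] -/
theorem outcome_eq_agree_iff {p : α} {tl : List α} {alts : List (List α)} (halts : alts ≠ [])
    (hgate : (structural p && !expectsStructural structural alts) = false) :
    outcome structural (p :: tl) alts = .AGREE ↔ ∃ a ∈ alts, fullMatch (p :: tl) a = true := by
  rw [outcome_cons, if_neg halts, if_neg (by simp [hgate]), ← List.any_eq_true]
  by_cases hm : alts.any (fullMatch (p :: tl)) = true
  · rw [if_pos hm]; exact ⟨fun _ => hm, fun _ => rfl⟩
  rw [if_neg hm]
  by_cases hq : alts.any (primaryEmitted (p :: tl)) = true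
  · rw [if_pos hq]; exact ⟨fun h => absurd h (by decide), fun h => absurd h hm⟩
  · rw [if_neg hq]; exact ⟨fun h => absurd h (by decide), fun h => absurd h hm⟩

/-- a full match emits the alternative's primary. [folklore] -/
theorem primaryEmitted_of_fullMatch {p : α} {tl a : List α} (h : fullMatch (p :: tl) a = true) :
    primaryEmitted (p :: tl) a = true := by
  simp only [fullMatch, Bool.and_eq_true, decide_eq_true_eq, List.head?_cons] at h
  unfold primaryEmitted
  rw [h.1]
  simp

/-- a `PARTIAL` or `AGREE` verdict certifies that some alternative's primary was emitted (the converse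
direction of the honesty test: `DISAGREE` means no expected primary appears at all). [folklore] -/
theorem primary_emitted_of_not_disagree {p : α} {tl : List α} {alts : List (List α)}
    (halts : alts ≠ []) (hgate : (structural p && !expectsStructural structural alts) = false)
    (h : outcome structural (p :: tl) alts ≠ .DISAGREE) :
    ∃ a ∈ alts, primaryEmitted (p :: tl) a = true := by
  rw [outcome_cons, if_neg halts, if_neg (by simp [hgate])] at h
  rw [← List.any_eq_true]
  by_cases hm : alts.any (fullMatch (p :: tl)) = true
  · exact any_mono (fun a ha => primaryEmitted_of_fullMatch ha) hm
  rw [if_neg hm] at h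
  by_cases hq : alts.any (primaryEmitted (p :: tl)) = true
  · exact hq
  · rw [if_neg hq] at h; exact absurd rfl h

end props

/-! ## §4 The code heads of the ROUTER grammar (ACCEPTANCE v1.2 §2.1) -/

/-- Code HEADS of router words (`UND:HF(…)` ↦ `hf`, …); `other n` keeps the type open like the
grammar's `UND:<TAG>`. [folklore] -/
inductive Head
  | eph | bh1 | be3 | bi | ci | sa | bilayer1bh | weakCoupling
  | undStruct | undDisputed | undHF | undMixed | undMultiorb | undFlat | undLattice
  | other (n : ℕ)
  deriving DecidableEq, Repr

/-- the two structural heads `UND:STRUCT`, `UND:DISPUTED` [folklore] -/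
def Head.structural : Head → Bool
  | .undStruct | .undDisputed => true
  | _ => false

/-- the score on code heads, as both python engines compute it [folklore] -/
abbrev score (e : List Head) (alts : List (List Head)) : Outcome := outcome Head.structural e alts

/-! ## §5 The 23 cross-test cases (`router_score.py test` = deputy-2 `score.py::router_score`),
now three-way: python = python = kernel -/

section cases
open Head
example : score [eph] [[eph]] = .AGREE := by decide
example : score [eph, bh1] [[eph]] = .AGREE := by decide                      -- extra secondary never hurts
example : score [bh1, be3] [[bh1, be3]] = .AGREE := by decide                 -- LSCO doped
example : score [bh1, be3, ci] [[bh1, be3, ci]] = .AGREE := by decide         -- La₂CuO₄ with CI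
example : score [bh1, be3] [[bh1, be3, ci]] = .PARTIAL := by decide           -- CI annotation missing
example : score [be3, bh1] [[bh1, be3]] = .PARTIAL := by decide               -- primary/secondary swapped
example : score [eph] [[bh1, be3]] = .DISAGREE := by decide                   -- cuprate routed to e-ph
example : score [bh1] [[undHF]] = .DISAGREE := by decide                      -- HONESTY TEST failed
example : score [undHF] [[undHF]] = .AGREE := by decide                       -- heads compared
example : score [undStruct] [[eph]] = .ABSTAIN_structure := by decide          -- structure abstention
example : score [undDisputed] [[eph]] = .ABSTAIN_structure := by decide        -- disputed, not expected
example : score [undMixed, bh1, be3] [[bh1, be3]] = .PARTIAL := by decide     -- NCCO pre-registered T1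
example : score [undStruct, eph] [[eph], [undStruct], [undStruct, eph]] = .AGREE := by decide  -- H₃S@100
example : score [undDisputed] [[undFlat, ci], [undDisputed]] = .AGREE := by decide             -- LK-99 (2nd alt)
example : score [undFlat, ci] [[undFlat, ci], [undDisputed]] = .AGREE := by decide             -- LK-99 (§14 reading)
example : score [undFlat] [[undFlat, ci], [undDisputed]] = .PARTIAL := by decide               -- LK-99 without CI
example : score [undMultiorb, bilayer1bh] [[undMultiorb, bilayer1bh], [undMultiorb], [undStruct]] = .AGREE := by
  decide                                                                       -- La₃Ni₂O₇
example : score [eph] [[undMultiorb, eph], [undMultiorb]] = .DISAGREE := by decide             -- pnictide worded EPH-only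
example : score [eph, undMultiorb] [[undMultiorb, eph], [undMultiorb]] = .PARTIAL := by decide -- MULTIORB not primary
example : score [] [[eph]] = .ABSTAIN_noWord := by decide                      -- nothing emitted
example : score [eph] [] = .UNSCORED := by decide                             -- no expectation (hold-out)
example : score [eph, sa] [[eph], [eph, undStruct]] = .AGREE := by decide     -- H₃S «EPH+SA» of record
example : score [undHF] [[undHF], [undHF, eph]] = .AGREE := by decide         -- CeCoIn₅ honesty test passed
end cases

end RouterScore

end Summit.Ventures.CertifiedManyBodySolver.Downfold
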